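import Mathlib
import Summits.ValiantsHypothesis.ValiantsHypothesis.Theorems.LacunarySymmetroidMatrixDescartesDefiniteMomentsWordZeros
import Summits.ValiantsHypothesis.ValiantsHypothesis.Theorems.LacunarySymmetroidMatrixDescartesSignWordLawMDR

/-!
# `MatrixDescartes` (stmt-ValiantsHypothesis-18050) — the DEFINITE-MOMENTS LAW for semidefinite sign words with interior
# definite moments: «V sign changes + V − 1 alternating definite moments ⇒ Z₊ ≤ V·m» (K-free, magnitude-free)

HONEST FRAMING.  Cell `pub-symmetroid`, seat `val-sym-mdr-p2` (gen 14); helper file `--supports` the crux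
`Theses.LacunarySymmetroid.MatrixDescartes`, NO closure claim.  A K-free SECTOR law whose only hypotheses beyond the
semidefinite sign word are finitely many POINTWISE definiteness conditions; nothing here bears on the crux in its window,
on `stub_twoSided`, on `DoorA26`/`DoorA34`, registers, or `VP ≠ VNP`.  (Light re-cut of the pending `…DefiniteMomentsWord`
over `…DefiniteMomentsWordZeros`; same mathematics.)

THE LAW (`card_posRoots_le_of_wordMoments`).  `F(x) = ∑ₖ x^{dₖ} Sₖ`, real symmetric `ι × ι` letters over any finite
letter type, natural exponents (ties allowed).  SIGN WORD: a monotone block index `β : ℕ → ℕ` on exponents, `β ≤ N + 2`,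
with `(−1)^{β(dₖ)} Sₖ ⪰ 0` — block `0` positive semidefinite, block `1` negative semidefinite, … (at most `V = N + 2` sign
changes; any number of letters per block).  MOMENTS: scales `0 < t₀ < ⋯ < t_N` (`V − 1` of them) with
`(−1)^{j+1} F(tⱼ) ≻ 0`.  THEN `det F` has at most `(N + 2)·card ι = V·m` distinct positive zeros: at most `card ι` in
`(0, t₀)`, in each `(tᵢ, tᵢ₊₁)`, and in `(t_N, ∞)`, and none at the `tⱼ`.  `V = 2` (`card_posRoots_le_of_negativeMoment`): a
`(+)(−)(+)` word of semidefinite blocks that is NEGATIVE DEFINITE AT ONE SCALE has `Z₊ ≤ 2m` — the tree's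
`negMoment_posRoots_le` (one pivot LETTER) extended to a multi-letter middle block, and `dominantMiddle`'s count without its two
dominance inequalities; general `V`: `signWord_posRoots_le`'s count with the `2(α−1)` endpoint dominances replaced by `α − 1`
pointwise signs.  `V = 1` is the tree's `oneAlternation`.  The other global sign is the statement for `−F`.  Sharp (diagonal
words).  PROOF.  Per vector, `wordZeros` (budget saturation: every zero of a Rayleigh form is a forced gap zero) gives the
three window facts (`wordWindows`); per window, the directed kernel chain (`card_roots_filter_le_of_directed_down`,
`card_roots_window_le`: Duffin–Markus nested cones); the windows cover `(0, ∞) ∖ {tⱼ}` and `det F(tⱼ) ≠ 0`.  Crux currency: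
`wordMoments_realRoots_le` (one parity), `wordMoments_mdr`.  [folklore]; axioms `propext`, `Classical.choice`, `Quot.sound`.
-/

-- layout Summits/ValiantsHypothesis/ValiantsHypothesis forces the duplicated namespace component
set_option linter.dupNamespace false

namespace Summit.ValiantsHypothesis.ValiantsHypothesis.Theorems.LacunarySymmetroidMatrixDescartes

open Polynomial Matrix Finset
open scoped BigOperators

namespace DefiniteMoments

section Word

variable {ι κ : Type} [Fintype ι] [DecidableEq ι] [Fintype κ]

omit [DecidableEq ι] in
/-- **Window facts for one Rayleigh form** (from `wordZeros`): for `v ≠ 0`, (1) each interior gap `(tᵢ, tᵢ₊₁)` carries at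
most one zero of `f_v`; (2) on `(0, t₀)`, `0 ≤ f_v(s′) ⇒ 0 < f_v(s)` for `s < s′`; (3) on `(t_N, ∞)` the same for
`(−1)^{N+1} f_v`. [folklore] -/
theorem wordWindows (d : κ → ℕ) (S : κ → Matrix ι ι ℝ) (β : ℕ → ℕ) (hβ : Monotone β) (N : ℕ)
    (hβN : ∀ n, β n ≤ N + 2) (hsign : ∀ k, (((-1 : ℝ) ^ β (d k)) • S k).PosSemidef)
    (t : Fin (N + 1) → ℝ) (ht : StrictMono t) (ht0 : 0 < t 0)
    (hdef : ∀ (j : Fin (N + 1)) (v : ι → ℝ), v ≠ 0 →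
      0 < (-1 : ℝ) ^ ((j : ℕ) + 1) * (v ⬝ᵥ ((∑ k, t j ^ d k • S k) *ᵥ v)))
    (v : ι → ℝ) (hv : v ≠ 0) :
    (∀ i : Fin N, ∀ r₁ r₂ : ℝ, t i.castSucc < r₁ → r₁ < t i.succ → t i.castSucc < r₂ → r₂ < t i.succ →
        v ⬝ᵥ ((∑ k, r₁ ^ d k • S k) *ᵥ v) = 0 → v ⬝ᵥ ((∑ k, r₂ ^ d k • S k) *ᵥ v) = 0 → r₁ = r₂) ∧
    (∀ s s' : ℝ, 0 < s → s < s' → s' < t 0 →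
        0 ≤ v ⬝ᵥ ((∑ k, s' ^ d k • S k) *ᵥ v) → 0 < v ⬝ᵥ ((∑ k, s ^ d k • S k) *ᵥ v)) ∧
    (∀ s s' : ℝ, t (Fin.last N) < s → s < s' →
        0 ≤ (-1 : ℝ) ^ (N + 1) * (v ⬝ᵥ ((∑ k, s' ^ d k • S k) *ᵥ v)) →
        0 < (-1 : ℝ) ^ (N + 1) * (v ⬝ᵥ ((∑ k, s ^ d k • S k) *ᵥ v))) := by
  set f : ℝ → ℝ := fun x => v ⬝ᵥ ((∑ k, x ^ d k • S k) *ᵥ v) with hf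
  have hfc : Continuous f := continuous_form d S v
  have hft : ∀ j : Fin (N + 1), 0 < (-1 : ℝ) ^ ((j : ℕ) + 1) * f (t j) := fun j => hdef j v hv
  have hft0 : f (t 0) < 0 := by
    have h := hft 0
    rw [Fin.val_zero, zero_add, pow_one] at h
    linarith
  have htpos : ∀ j, 0 < t j := fun j => ht0.trans_le (ht.monotone (Fin.zero_le _))
  obtain ⟨u, M', δ, M, b₀, b₁, q, z, hqmono, hu0, huδ, hut, hM'M, hM't, hq_u, hq_t, hq_M, hnear, hfar, hz, hall⟩ :=
    wordZeros d S β hβ N hβN hsign t ht ht0 hdef v hv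
  have hq1 : q ⟨1, by omega⟩ = t 0 := hq_t _ 0 rfl
  have hqL : q ⟨N + 1, by omega⟩ = t (Fin.last N) := hq_t _ (Fin.last N) (by simp)
  -- consequences of «every zero is a forced gap zero»
  have hfirst : ∀ r : ℝ, 0 < r → r < t 0 → f r = 0 → r = z 0 ∧ 0 < f u := by
    intro r hr hrt hfr
    obtain ⟨i, hi, rfl⟩ := hall r hr hfr
    have hi0 : (i : ℕ) = 0 :=
      gap_index_eq_zero q hqmono i (z i) ⟨1, by omega⟩ rfl (hz i hi).1 (by rw [hq1]; exact hrt)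
    have hi0' : i = 0 := Fin.ext hi0
    subst hi0'
    refine ⟨rfl, ?_⟩
    have h := hi
    rw [hq_u _ (by simp), hq_t _ 0 (by simp)] at h
    change f u * f (t 0) < 0 at h
    nlinarith [hft0]
  have hlast : ∀ r : ℝ, t (Fin.last N) < r → f r = 0 →
      r = z (Fin.last (N + 1)) ∧ (-1 : ℝ) ^ (N + 1) * f M' < 0 := by
    intro r hr hfr
    obtain ⟨i, hi, rfl⟩ := hall r ((htpos _).trans hr) hfr
    have hiL : (i : ℕ) + 1 = N + 2 :=
      gap_index_eq_last q hqmono i (z i) ⟨N + 1, by omega⟩ rfl (by rw [hqL]; exact hr) (hz i hi).2.1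
    have hiL' : i = Fin.last (N + 1) := Fin.ext (by rw [Fin.val_last]; omega)
    subst hiL'
    refine ⟨rfl, ?_⟩
    have h := hi
    rw [hq_t _ (Fin.last N) (by simp), hq_M _ (by simp)] at h
    change f (t (Fin.last N)) * f M' < 0 at h
    have ha := hft (Fin.last N)
    rw [Fin.val_last] at ha
    rcases neg_one_pow_eq_or ℝ (N + 1) with h1 | h1 <;> rw [h1] at ha ⊢ <;> nlinarith
  have hinterior : ∀ (i : Fin N) (r : ℝ), t i.castSucc < r → r < t i.succ → f r = 0 →
      r = z ⟨(i : ℕ) + 1, by omega⟩ := by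
    intro i r hr1 hr2 hfr
    obtain ⟨i', hi', rfl⟩ := hall r ((htpos _).trans hr1) hfr
    have e : i' = ⟨(i : ℕ) + 1, by omega⟩ :=
      gap_eq_of_mem q hqmono i' ⟨(i : ℕ) + 1, by omega⟩ (z i') (hz i' hi').1 (hz i' hi').2.1
        (by rw [hq_t _ i.castSucc (by simp)]; exact hr1) (by rw [hq_t _ i.succ (by simp)]; exact hr2)
    rw [← e]
  refine ⟨?_, ?_, ?_⟩
  · -- (1) interior gaps carry at most one zero
    intro i r₁ r₂ h1 h1' h2 h2' hf1 hf2
    rw [hinterior i r₁ h1 h1' hf1, hinterior i r₂ h2 h2' hf2]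
  · -- (2) first window, downward propagation
    intro s s' hs hss' hs't hfs'
    show 0 < f s
    by_contra hfs
    push Not at hfs
    rcases neg_one_pow_eq_or ℝ b₀ with hε | hε
    · -- `f > 0` near `0⁺`
      set w : ℝ := min s δ / 2 with hw
      have hminw : 0 < min s δ := lt_min hs (hu0.trans huδ)
      have hw0 : 0 < w := by rw [hw]; linarith
      have hws : w < s := by rw [hw]; linarith [min_le_left s δ]
      have hwδ : w < δ := by rw [hw]; linarith [min_le_right s δ]
      have hfw : 0 < f w := by have h := hnear w hw0 hwδ; rw [hε, one_mul] at h; exact h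
      obtain ⟨r₁, hr₁, hfr₁⟩ : (0 : ℝ) ∈ f '' Set.Icc w s :=
        intermediate_value_Icc' hws.le hfc.continuousOn ⟨hfs, hfw.le⟩
      obtain ⟨r₂, hr₂, hfr₂⟩ : (0 : ℝ) ∈ f '' Set.Icc s' (t 0) :=
        intermediate_value_Icc' hs't.le hfc.continuousOn ⟨hft0.le, hfs'⟩
      have hr₁0 : 0 < r₁ := hw0.trans_le hr₁.1
      have hr₂t : r₂ < t 0 := lt_of_le_of_ne hr₂.2 (by rintro rfl; exact hft0.ne hfr₂)
      have e₁ := (hfirst r₁ hr₁0 (by linarith [hr₁.2]) hfr₁).1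
      have e₂ := (hfirst r₂ (hs.trans (hss'.trans_le hr₂.1)) hr₂t hfr₂).1
      have : r₁ = r₂ := by rw [e₁, e₂]
      linarith [hr₁.2, hr₂.1]
    · -- `f < 0` near `0⁺`: then `f(s') ≥ 0` is impossible
      set w : ℝ := min s' δ / 2 with hw
      have hminw : 0 < min s' δ := lt_min (hs.trans hss') (hu0.trans huδ)
      have hw0 : 0 < w := by rw [hw]; linarith
      have hws : w < s' := by rw [hw]; linarith [min_le_left s' δ]
      have hwδ : w < δ := by rw [hw]; linarith [min_le_right s' δ]
      have hfw : f w < 0 := by have h := hnear w hw0 hwδ; rw [hε] at h; linarith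
      obtain ⟨r, hr, hfr⟩ : (0 : ℝ) ∈ f '' Set.Icc w s' :=
        intermediate_value_Icc hws.le hfc.continuousOn ⟨hfw.le, hfs'⟩
      have hfu' := (hfirst r (hw0.trans_le hr.1) (lt_of_le_of_lt hr.2 hs't) hfr).2
      have h := hnear u hu0 huδ
      rw [hε] at h
      linarith
  · -- (3) last window, downward propagation for `(−1)^{N+1} f`
    intro s s' hs hss' hgs'
    show 0 < (-1 : ℝ) ^ (N + 1) * f s
    set g : ℝ → ℝ := fun x => (-1 : ℝ) ^ (N + 1) * f x with hg
    have hgc : Continuous g := continuous_const.mul hfc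
    have hgt : 0 < g (t (Fin.last N)) := by have h := hft (Fin.last N); rwa [Fin.val_last] at h
    have hgzero : ∀ x, g x = 0 → f x = 0 := fun x hx => by
      rcases mul_eq_zero.1 hx with h | h
      · exact absurd h (pow_ne_zero _ (by norm_num))
      · exact h
    show 0 < g s
    by_contra hgs
    push Not at hgs
    obtain ⟨r₁, hr₁, hgr₁⟩ : (0 : ℝ) ∈ g '' Set.Icc (t (Fin.last N)) s :=
      intermediate_value_Icc' hs.le hgc.continuousOn ⟨hgs, hgt.le⟩
    have hr₁t : t (Fin.last N) < r₁ := lt_of_le_of_ne hr₁.1 (by rintro h; rw [← h] at hgr₁; exact hgt.ne' hgr₁)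
    obtain ⟨e₁, hM'neg⟩ := hlast r₁ hr₁t (hgzero r₁ hgr₁)
    rcases lt_or_ge s' M' with hlt | hge
    · obtain ⟨r₂, hr₂, hgr₂⟩ : (0 : ℝ) ∈ g '' Set.Icc s' M' :=
        intermediate_value_Icc' hlt.le hgc.continuousOn ⟨hM'neg.le, hgs'⟩
      have e₂ := (hlast r₂ (hs.trans (hss'.trans_le hr₂.1)) (hgzero r₂ hgr₂)).1
      have : r₁ = r₂ := by rw [e₁, e₂]
      linarith [hr₁.2, hr₂.1]
    · have h1 := hfar M' hM'M
      have h2 := hfar s' (hM'M.trans_le hge)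
      change (-1 : ℝ) ^ (N + 1) * f M' < 0 at hM'neg
      change 0 ≤ (-1 : ℝ) ^ (N + 1) * f s' at hgs'
      rcases neg_one_pow_eq_or ℝ (N + 1) with ha | ha <;> rcases neg_one_pow_eq_or ℝ b₁ with hb | hb <;>
        rw [ha] at hM'neg hgs' <;> rw [hb] at h1 h2 <;> linarith

/-- Locating a point among finitely many scales: a point strictly between `t₀` and `t_N` that is none of the `tⱼ`
lies in some open gap `(tᵢ, tᵢ₊₁)` (take the largest `j` with `tⱼ < x`). [folklore] -/
theorem exists_gap_of_between {N : ℕ} (t : Fin (N + 1) → ℝ) {x : ℝ} (h0 : t 0 < x)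
    (hN : x < t (Fin.last N)) (hne : ∀ j, x ≠ t j) : ∃ i : Fin N, t i.castSucc < x ∧ x < t i.succ := by
  set J := (Finset.univ : Finset (Fin (N + 1))).filter (fun j => t j < x) with hJ
  have hJne : J.Nonempty := ⟨0, Finset.mem_filter.2 ⟨Finset.mem_univ _, h0⟩⟩
  set j₀ := J.max' hJne with hj₀
  have hj₀mem : j₀ ∈ J := J.max'_mem hJne
  have hj₀lt : t j₀ < x := (Finset.mem_filter.1 hj₀mem).2
  have hj₀N : (j₀ : ℕ) < N := by
    by_contra h
    have e : j₀ = Fin.last N := Fin.ext (le_antisymm (Nat.le_of_lt_succ j₀.isLt) (by rw [Fin.val_last]; omega))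
    rw [e] at hj₀lt
    linarith
  refine ⟨⟨j₀, hj₀N⟩, ?_, ?_⟩
  · have e : (⟨(j₀ : ℕ), hj₀N⟩ : Fin N).castSucc = j₀ := Fin.ext rfl
    rw [e]; exact hj₀lt
  · set j₁ : Fin (N + 1) := (⟨(j₀ : ℕ), hj₀N⟩ : Fin N).succ with hj₁
    rcases lt_trichotomy x (t j₁) with h | h | h
    · exact h
    · exact absurd h (hne j₁)
    · have hmem : j₁ ∈ J := Finset.mem_filter.2 ⟨Finset.mem_univ _, h⟩
      have hle : j₁ ≤ j₀ := J.le_max' j₁ hmem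
      have : (j₁ : ℕ) = (j₀ : ℕ) + 1 := by rw [hj₁]; simp
      exact absurd (Fin.le_def.1 hle) (by omega)

/-- **THE DEFINITE-MOMENTS LAW FOR SIGN WORDS.**  `F(x) = ∑ₖ x^{dₖ} Sₖ` with real symmetric letters, natural exponents;
`β : ℕ → ℕ` monotone with `β ≤ N + 2` and `(−1)^{β(dₖ)} Sₖ ⪰ 0` (a semidefinite sign word with at most `N + 2` sign
changes, block `0` positive semidefinite); scales `0 < t₀ < ⋯ < t_N` with `(−1)^{j+1}·vᵀF(tⱼ)v > 0` for all `v ≠ 0`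
(alternating DEFINITE moments, the `j`-th with the sign of block `j+1`).  Then `det (∑ₖ X^{dₖ} Sₖ)` has at most
`(N + 2)·card ι` distinct positive zeros.  K-free, magnitude-free; sharp. [folklore] -/
theorem card_posRoots_le_of_wordMoments (d : κ → ℕ) (S : κ → Matrix ι ι ℝ) (hS : ∀ k, (S k).IsSymm)
    (β : ℕ → ℕ) (hβ : Monotone β) (N : ℕ) (hβN : ∀ n, β n ≤ N + 2)
    (hsign : ∀ k, (((-1 : ℝ) ^ β (d k)) • S k).PosSemidef)
    (t : Fin (N + 1) → ℝ) (ht : StrictMono t) (ht0 : 0 < t 0)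
    (hdef : ∀ (j : Fin (N + 1)) (v : ι → ℝ), v ≠ 0 →
      0 < (-1 : ℝ) ^ ((j : ℕ) + 1) * (v ⬝ᵥ ((∑ k, t j ^ d k • S k) *ᵥ v))) :
    ((Matrix.det (∑ k, ((X : ℝ[X]) ^ d k) • (S k).map C)).roots.toFinset.filter
        (fun x => 0 < x)).card ≤ (N + 2) * Fintype.card ι := by
  set p := Matrix.det (∑ k, ((X : ℝ[X]) ^ d k) • (S k).map C) with hp
  have hdata := fun v hv => wordWindows d S β hβ N hβN hsign t ht ht0 hdef v hv
  -- first window `(0, t₀)`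
  have hfirst : (p.roots.toFinset.filter (fun x => 0 < x ∧ x < t 0)).card ≤ Fintype.card ι := by
    refine card_roots_filter_le_of_directed_down d S hS 1 (fun x => 0 < x ∧ x < t 0) ?_
    intro v hv s s' hs hs' hss' h
    rw [one_mul] at h ⊢
    exact (hdata v hv).2.1 s s' hs.1 hss' hs'.2 h
  -- interior windows `(tᵢ, tᵢ₊₁)`
  have hint : ∀ i : Fin N,
      (p.roots.toFinset.filter (fun x => t i.castSucc < x ∧ x < t i.succ)).card ≤ Fintype.card ι := by
    intro i
    refine card_roots_window_le d S hS ((-1 : ℝ) ^ ((i : ℕ) + 1)) ?_ ?_ (hdata · · |>.1 i)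
    · intro v hv
      have h := hdef i.castSucc v hv
      rwa [Fin.val_castSucc] at h
    · intro v hv
      have h := hdef i.succ v hv
      rw [Fin.val_succ, pow_succ] at h
      have e : (-1 : ℝ) ^ ((i : ℕ) + 1) * -1 * (v ⬝ᵥ ((∑ k, t i.succ ^ d k • S k) *ᵥ v))
          = -((-1 : ℝ) ^ ((i : ℕ) + 1) * (v ⬝ᵥ ((∑ k, t i.succ ^ d k • S k) *ᵥ v))) := by ring
      rw [e] at h
      linarith
  -- last window `(t_N, ∞)`
  have hlast : (p.roots.toFinset.filter (fun x => t (Fin.last N) < x)).card ≤ Fintype.card ι := by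
    refine card_roots_filter_le_of_directed_down d S hS ((-1 : ℝ) ^ (N + 1)) (fun x => t (Fin.last N) < x) ?_
    intro v hv s s' hs _ hss' h
    exact (hdata v hv).2.2 s s' hs hss' h
  -- no zero at a moment
  have hnot : ∀ (j : Fin (N + 1)) (x : ℝ), x ∈ p.roots.toFinset → x ≠ t j := by
    intro j x hx hxt
    subst hxt
    obtain ⟨v, hv, hFv⟩ := Matrix.exists_mulVec_eq_zero_iff.2 (det_eval_eq_zero_of_mem d S hx)
    have h := hdef j v hv
    rw [hFv, dotProduct_zero, mul_zero] at h
    exact lt_irrefl 0 h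
  -- the windows cover the positive zeros
  have hsub : p.roots.toFinset.filter (fun x => 0 < x) ⊆
      (p.roots.toFinset.filter (fun x => 0 < x ∧ x < t 0) ∪
        (Finset.univ : Finset (Fin N)).biUnion
          (fun i => p.roots.toFinset.filter (fun x => t i.castSucc < x ∧ x < t i.succ))) ∪
        p.roots.toFinset.filter (fun x => t (Fin.last N) < x) := by
    intro x hx
    rw [Finset.mem_filter] at hx
    obtain ⟨hxr, hx0⟩ := hx
    rw [Finset.mem_union, Finset.mem_union, Finset.mem_biUnion]
    rcases lt_or_ge x (t 0) with h0 | h0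
    · exact Or.inl (Or.inl (Finset.mem_filter.2 ⟨hxr, hx0, h0⟩))
    · rcases lt_or_ge (t (Fin.last N)) x with hL | hL
      · exact Or.inr (Finset.mem_filter.2 ⟨hxr, hL⟩)
      · have h0' : t 0 < x := lt_of_le_of_ne h0 (fun h => hnot 0 x hxr h.symm)
        have hL' : x < t (Fin.last N) := lt_of_le_of_ne hL (hnot _ x hxr)
        obtain ⟨i, hi1, hi2⟩ := exists_gap_of_between t h0' hL' (fun j => hnot j x hxr)
        exact Or.inl (Or.inr ⟨i, Finset.mem_univ _, Finset.mem_filter.2 ⟨hxr, hi1, hi2⟩⟩)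
  calc (p.roots.toFinset.filter (fun x => 0 < x)).card
      ≤ ((p.roots.toFinset.filter (fun x => 0 < x ∧ x < t 0) ∪
          (Finset.univ : Finset (Fin N)).biUnion
            (fun i => p.roots.toFinset.filter (fun x => t i.castSucc < x ∧ x < t i.succ))) ∪
          p.roots.toFinset.filter (fun x => t (Fin.last N) < x)).card := Finset.card_le_card hsub
    _ ≤ ((p.roots.toFinset.filter (fun x => 0 < x ∧ x < t 0)).card +
          ((Finset.univ : Finset (Fin N)).biUnion
            (fun i => p.roots.toFinset.filter (fun x => t i.castSucc < x ∧ x < t i.succ))).card) +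
          (p.roots.toFinset.filter (fun x => t (Fin.last N) < x)).card :=
        (Finset.card_union_le _ _).trans (Nat.add_le_add_right (Finset.card_union_le _ _) _)
    _ ≤ (Fintype.card ι + ∑ i : Fin N, Fintype.card ι) + Fintype.card ι := by
        refine Nat.add_le_add (Nat.add_le_add hfirst (Finset.card_biUnion_le.trans ?_)) hlast
        exact Finset.sum_le_sum fun i _ => hint i
    _ = (N + 2) * Fintype.card ι := by
        rw [Finset.sum_const, Finset.card_univ, Fintype.card_fin, smul_eq_mul]; ring

/-- **THE NEGATIVE-MOMENT LAW FOR WORDS (`V = 2`).**  `F(x) = ∑ₖ x^{dₖ} Sₖ`, real symmetric letters in three consecutive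
blocks along the exponent axis with signs `(+)(−)(+)` (semidefinite: `(−1)^{β(dₖ)} Sₖ ⪰ 0` for a monotone `β ≤ 2`, any
number of letters per block, ties allowed).  If `F` is NEGATIVE DEFINITE AT ONE SCALE `t₀ > 0`, then `det F` has at most
`2·card ι` distinct positive zeros — at most `card ι` on each side of `t₀`.  (The tree's `negMoment_posRoots_le` is the
case of a one-letter middle block; `dominantMiddle` reaches the same count under two dominance inequalities.)
[folklore] -/
theorem card_posRoots_le_of_negativeMoment (d : κ → ℕ) (S : κ → Matrix ι ι ℝ) (hS : ∀ k, (S k).IsSymm)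
    (β : ℕ → ℕ) (hβ : Monotone β) (hβ2 : ∀ n, β n ≤ 2) (hsign : ∀ k, (((-1 : ℝ) ^ β (d k)) • S k).PosSemidef)
    (t₀ : ℝ) (ht₀ : 0 < t₀) (hneg : ∀ v : ι → ℝ, v ≠ 0 → v ⬝ᵥ ((∑ k, t₀ ^ d k • S k) *ᵥ v) < 0) :
    ((Matrix.det (∑ k, ((X : ℝ[X]) ^ d k) • (S k).map C)).roots.toFinset.filter
        (fun x => 0 < x)).card ≤ 2 * Fintype.card ι := by
  have h := card_posRoots_le_of_wordMoments d S hS β hβ 0 hβ2 hsign (fun _ => t₀)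
    (fun a b hab => absurd hab (by rw [Fin.lt_def]; omega)) ht₀ (fun j v hv => by
      rw [Fin.val_eq_zero j, zero_add, pow_one]
      linarith [hneg v hv])
  simpa using h


/-! ## Crux currency: all real zeros (exponents of one parity) and the inequality at every fat format -/

/-- **Real zeros of a sign word with interior definite moments, exponents of one parity**: the reflected pencil
`F(−X)` is `±F(X)`, so `det F` has at most `2·(N+2)·m + 1` distinct real zeros (positive zeros of `F` and of `F(−X)`,
and the origin; tree `stub_negRoots`, `posRoots_reflect_of_parity`). [folklore] -/
theorem wordMoments_realRoots_le (K m : ℕ) (d : Fin K → ℕ) (S : Fin K → Matrix (Fin m) (Fin m) ℝ)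
    (hS : ∀ l, (S l).IsSymm) (hpar : (∀ l, Even (d l)) ∨ (∀ l, Odd (d l)))
    (β : ℕ → ℕ) (hβ : Monotone β) (N : ℕ) (hβN : ∀ n, β n ≤ N + 2)
    (hsign : ∀ l, (((-1 : ℝ) ^ β (d l)) • S l).PosSemidef)
    (t : Fin (N + 1) → ℝ) (ht : StrictMono t) (ht0 : 0 < t 0)
    (hdef : ∀ (j : Fin (N + 1)) (v : Fin m → ℝ), v ≠ 0 →
      0 < (-1 : ℝ) ^ ((j : ℕ) + 1) * (v ⬝ᵥ ((∑ l, t j ^ d l • S l) *ᵥ v))) :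
    (Matrix.det (∑ l, ((Polynomial.X : Polynomial ℝ) ^ d l) • (S l).map Polynomial.C)
      ).roots.toFinset.card ≤ 2 * ((N + 2) * m) + 1 := by
  have h1 := card_posRoots_le_of_wordMoments d S hS β hβ N hβN hsign t ht ht0 hdef
  have h2 := posRoots_reflect_of_parity K m d S hpar
  have h3 := stub_negRoots K m d S
  rw [Fintype.card_fin] at h1
  rw [h2] at h3
  omega

/-- **The crux's inequality on sign words with interior definite moments, at every admissible size.**  For all `c, q`
there is `K₀` such that for all `K ≥ K₀`, all `m ≤ 2^((⌊log₂K⌋+c)^c)`, all exponents of one parity, and all real symmetric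
`m × m` letters forming a semidefinite sign word with at most `N + 2 ≤ K` sign changes that is definite with alternating
signs at `N + 1` interior scales, the number `Z` of distinct real zeros of `det (∑ₗ X^{dₗ} Sₗ)` satisfies
`Z^q ≤ 2^(K⌊log₂K⌋)` — `MatrixDescartes` restricted to this format family, fat formats included; nothing is claimed
outside it. [folklore] -/
theorem wordMoments_mdr (c q : ℕ) : ∃ K₀ : ℕ, ∀ K m : ℕ, K₀ ≤ K → m ≤ 2 ^ ((Nat.log 2 K + c) ^ c) →
    ∀ (d : Fin K → ℕ), ((∀ l, Even (d l)) ∨ (∀ l, Odd (d l))) →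
    ∀ (S : Fin K → Matrix (Fin m) (Fin m) ℝ), (∀ l, (S l).IsSymm) →
    ∀ (β : ℕ → ℕ), Monotone β → ∀ (N : ℕ), N + 2 ≤ K → (∀ n, β n ≤ N + 2) →
    (∀ l, (((-1 : ℝ) ^ β (d l)) • S l).PosSemidef) →
    ∀ (t : Fin (N + 1) → ℝ), StrictMono t → 0 < t 0 →
    (∀ (j : Fin (N + 1)) (v : Fin m → ℝ), v ≠ 0 →
      0 < (-1 : ℝ) ^ ((j : ℕ) + 1) * (v ⬝ᵥ ((∑ l, t j ^ d l • S l) *ᵥ v))) →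
    (Matrix.det (∑ l, ((Polynomial.X : Polynomial ℝ) ^ d l) • (S l).map Polynomial.C)
      ).roots.toFinset.card ^ q ≤ 2 ^ (K * Nat.log 2 K) := by
  obtain ⟨K₀, hK₀⟩ := Census.fatFormat_absorb 1 c q
  refine ⟨K₀, fun K m hK hm d hpar S hS β hβ N hNK hβN hsign t ht ht0 hdef => hK₀ K m _ hK hm ?_⟩
  have hZ := wordMoments_realRoots_le K m d S hS hpar β hβ N hβN hsign t ht ht0 hdef
  have h1 : (N + 2) * m ≤ K * m := Nat.mul_le_mul_right m hNK
  have h4 : 2 * ((N + 2) * m) + 1 ≤ 2 ^ 1 * (m + 1) * (K + 1) := by nlinarith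
  exact hZ.trans h4

end Word

end DefiniteMoments

end Summit.ValiantsHypothesis.ValiantsHypothesis.Theorems.LacunarySymmetroidMatrixDescartes
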